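import Summits.CriticalPhenomena.Ising3DConformalLimit.Theorems.SubPtolemyFloor.Negative.TransferCostume
import HarnessLib

/-!
# `SubPtolemyFloor` (item stmt-CriticalPhenomena-15703): the round-2 idea `box-hyperscaling-isotherm`
# — its exponent-free factor `MirrorBox` is a one-arm UPPER bound, and modulo `MirrorBox` the crux is
# the one-arm floor / the dead `WallCost` stub

Negative / structural knowledge about the crux
`Summit.CriticalPhenomena.Ising3DConformalLimit.Theses.SubPtolemyInterlacing.SubPtolemyFloor`
(route SubPtolemyInterlacing, r3), from the crux-triage panel (round 2, triager 2; evidence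
`Cruxes/SubPtolemyFloor/TRIAGE-r2-2.md`); THEOREM-ONLY, no new definitions.
Notation: `g(n) = ⟨σ₀σ_{n e₁}⟩_{β_c(3)}`, `M_n = ⟨σ₀⟩⁺_{Λ_n;β_c,0}` (= the wired FK–Ising one-arm
probability `φ¹_{Λ_n,p_c}[0 ↔ ∂Λ_n]`), `L = log₂(1+√2) = 1.27155…`.

The card `box-hyperscaling-isotherm` proposes `SubPtolemyFloor ⟸ MirrorBox(K) ∧ IsothermFloor(δ₀ > 1 + 4/L)` with
`MirrorBox(K) : ∀ n ≥ 1, M_n² ≤ K·g(2n+2)` ("exponent-free", "not an upper bound on `M_n`"). This file records: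

* `boxMag_le_rpow_of_mirrorBox` — **`MirrorBox(K)` alone is a polynomially decaying UPPER bound on the
  critical wired one-arm probability in `d = 3`**: `M_n ≤ C·n^{-1/2}` (infrared bound `g ≤ K₁/n` and axial
  monotonicity) — the open problem of van Engelenburg–Garban–Panis–Severo 2025 (remark after Thm 1.12), i.e.
  the very wall at which the line `Sketch-plus-wall-quotient-ladder` died (`wallCost_consequences`).
* `wallCost_of_mirrorBox_of_axisFloor`, `stubWallCost_of_mirrorBox_of_crux` — **`MirrorBox(K) ∧ crux(a) ⇒
  WallCost(a/2)`**, `2·(a/2) = a < L`: the card's conjunction passes THROUGH the dead engine stub `stub_wallCost`.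
* `oneArmFloor_of_axisFloor`, `oneArmFloor_of_crux` — the crux already gives the one-arm floor `M_n ≥ c' n^{-s}`,
  `2s < L` (landed decoupling `g(2n+2) ≤ M_n²`, p130950): the card's intermediate currency is NECESSARY.
* `crux_of_mirrorBox_of_oneArmFloor`, `crux_iff_oneArmFloor_of_mirrorBox` — **given `MirrorBox(K)` the crux is
  EQUIVALENT to the one-arm floor with `2s < L`** (rigorous one-arm frontier in `d = 3`: `s = 1` all `n`
  (Tasaki / `boxMag_ge_inv`), `3/4 + o(1)` conditional on `η`-existence, vEGPS 2025 Thm 1.12); the card reaches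
  it only through the isotherm at `s = 2/(δ₀-1)`, i.e. `δ₀ > 1 + 4/L = 4.1458` against the rigorous `δ ≥ 3`
  (Aizenman–Barsky–Fernández 1987, mean field, no improvement in `d = 3` in print).

References: D. van Engelenburg, C. Garban, R. Panis, F. Severo, arXiv:2510.23423 (2025), Thm 1.1, Thm 1.12
and the remark after it; H. Duminil-Copin, *Lectures on the Ising and Potts models on the hypercubic
lattice* (2019), Thm 4.8 (infrared bound); A. Messager, S. Miracle-Solé, J. Stat. Phys. 17 (1977)
(monotonicity); S. Friedli, Y. Velenik, *Statistical Mechanics of Lattice Systems* (2017), Ex. 3.15 (GKS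
decoupling, the landed `stub_plusWallDecoupling`).
-/

noncomputable section

namespace Summit.CriticalPhenomena.Ising3DConformalLimit.SubPtolemyFloorNegative

open scoped BigOperators Classical
open Finset Literature.Probability.LatticeModels
open Summit.CriticalPhenomena.Ising3DConformalLimit.Theses.SubPtolemyInterlacing

/-! ## §C box-hyperscaling-isotherm: `MirrorBox` is a one-arm upper bound; modulo it the crux is the one-arm floor -/

/-- Infrared bound on the axis in the form used below: `g(n) ≤ (K₁+1)/n` for some `K₁ ≥ 0`. [cite: DuminilCopin2019, Thm. 4.8, §4.4 (infrared bound)] -/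
theorem exists_axis_le_inv :
    ∃ K₁ : ℝ, 0 < K₁ ∧ ∀ n : ℕ, 1 ≤ n →
      criticalTwoPoint 3 ((n : ℤ) • (Pi.single 0 1 : Site 3)) ≤ K₁ * (n : ℝ)⁻¹ := by
  obtain ⟨K, hK0, hK⟩ := exists_criticalTwoPoint_le_inv_pow (d := 3) le_rfl
  refine ⟨K + 1, by positivity, fun n hn => ?_⟩
  have hn0 : (0 : ℝ) < n := by exact_mod_cast hn
  have hIR := hK _ (SubPtolemyFloorNegative.axis_ne_zero hn)
  rw [SubPtolemyFloorNegative.supNorm_axis] at hIR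
  refine hIR.trans ?_
  norm_num
  exact mul_le_mul_of_nonneg_right (by linarith) (inv_nonneg.2 hn0.le)

/-- Axial monotonicity at the doubling scale: `g(2n+2) ≤ g(n)`. [cite: MessagerMiracleSoleJSP1977, main theorem (monotonicity of ⟨σ₀σ_x⟩ under reflections)] -/
theorem axis_double_succ_le (n : ℕ) :
    criticalTwoPoint 3 (((2 * n + 2 : ℕ) : ℤ) • (Pi.single 0 1 : Site 3)) ≤
      criticalTwoPoint 3 ((n : ℤ) • (Pi.single 0 1 : Site 3)) := by
  rw [zsmul_single_zero_one, zsmul_single_zero_one]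
  exact criticalTwoPoint_axis_antitone (show n ≤ 2 * n + 2 by omega)

/-- **`MirrorBox(K)` ⇒ a polynomially decaying UPPER bound on the critical wired one-arm probability in
`d = 3`**: `M_n = ⟨σ₀⟩⁺_{Λ_n;β_c} ≤ C·n^{-1/2}` (`M_n² ≤ K g(2n+2) ≤ K g(n) ≤ K K₁/n`). Such a bound — with ANY
negative exponent — is stated OPEN in van Engelenburg–Garban–Panis–Severo 2025 (remark after Thm 1.12); it is
the wall at which `Sketch-plus-wall-quotient-ladder` died. So `MirrorBox` is not "exponent-free bookkeeping":
it asserts one-arm exponent `≥ 1/2`. [cite: VanEngelenburgGarbanPanisSevero2025, remark after Thm. 1.12 (polynomial upper bound on the one-arm probability in d = 3 open)] -/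
theorem boxMag_le_rpow_of_mirrorBox {K : ℝ} (hK : 0 < K)
    (hMB : ∀ n : ℕ, 1 ≤ n →
      isingCorr (zdGraph 3) (box 3 n) (criticalBeta 3) 0 BoundaryCondition.plus {0} ^ 2 ≤
        K * criticalTwoPoint 3 (((2 * n + 2 : ℕ) : ℤ) • (Pi.single 0 1 : Site 3))) :
    ∃ C : ℝ, 0 < C ∧ ∀ n : ℕ, 1 ≤ n →
      isingCorr (zdGraph 3) (box 3 n) (criticalBeta 3) 0 BoundaryCondition.plus {0} ≤
        C * (n : ℝ) ^ (-(1 / 2 : ℝ)) := by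
  obtain ⟨K₁, hK₁, hIR⟩ := exists_axis_le_inv
  refine ⟨Real.sqrt (K * K₁), by positivity, fun n hn => ?_⟩
  have hn0 : (0 : ℝ) < n := by exact_mod_cast hn
  set M := isingCorr (zdGraph 3) (box 3 n) (criticalBeta 3) 0 BoundaryCondition.plus {0} with hM
  have hM0 : 0 ≤ M := SubPtolemyFloorPlusWall.boxMag_nonneg n
  have hsq : M ^ 2 ≤ K * K₁ * (n : ℝ)⁻¹ := by
    calc M ^ 2 ≤ K * criticalTwoPoint 3 (((2 * n + 2 : ℕ) : ℤ) • (Pi.single 0 1 : Site 3)) := hMB n hn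
      _ ≤ K * (K₁ * (n : ℝ)⁻¹) :=
          mul_le_mul_of_nonneg_left ((axis_double_succ_le n).trans (hIR n hn)) hK.le
      _ = K * K₁ * (n : ℝ)⁻¹ := by ring
  have hhalf : (n : ℝ) ^ (-(1 / 2 : ℝ)) = Real.sqrt ((n : ℝ)⁻¹) := by
    rw [Real.sqrt_eq_rpow, Real.inv_rpow hn0.le, Real.rpow_neg hn0.le]
  have htarget : (Real.sqrt (K * K₁) * (n : ℝ) ^ (-(1 / 2 : ℝ))) ^ 2 = K * K₁ * (n : ℝ)⁻¹ := by
    rw [hhalf, mul_pow, Real.sq_sqrt (by positivity), Real.sq_sqrt (by positivity)]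
  have h0 : 0 ≤ Real.sqrt (K * K₁) * (n : ℝ) ^ (-(1 / 2 : ℝ)) := by positivity
  exact (pow_le_pow_iff_left₀ hM0 h0 two_ne_zero).1 (htarget ▸ hsq)

/-- **`MirrorBox(K)` ∧ axial floor `(a, c)` ⇒ `WallCost(a/2)`**: `M_n ≤ √(K/c)·n^{a/2}·g(n)`
(`M_n² ≤ K g(2n+2) ≤ K g(n) ≤ K c⁻¹ n^a g(n)²`). [folklore] -/
theorem wallCost_of_mirrorBox_of_axisFloor {K a c : ℝ} (hK : 0 < K) (hc : 0 < c)
    (hMB : ∀ n : ℕ, 1 ≤ n →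
      isingCorr (zdGraph 3) (box 3 n) (criticalBeta 3) 0 BoundaryCondition.plus {0} ^ 2 ≤
        K * criticalTwoPoint 3 (((2 * n + 2 : ℕ) : ℤ) • (Pi.single 0 1 : Site 3)))
    (h : ∀ n : ℕ, 1 ≤ n →
      c * (n : ℝ) ^ (-a) ≤ criticalTwoPoint 3 ((n : ℤ) • (Pi.single 0 1 : Site 3))) :
    ∀ n : ℕ, 1 ≤ n →
      isingCorr (zdGraph 3) (box 3 n) (criticalBeta 3) 0 BoundaryCondition.plus {0} ≤
        Real.sqrt (K / c) * (n : ℝ) ^ (a / 2) * criticalTwoPoint 3 ((n : ℤ) • (Pi.single 0 1 : Site 3)) := by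
  intro n hn
  have hn0 : (0 : ℝ) < n := by exact_mod_cast hn
  set M := isingCorr (zdGraph 3) (box 3 n) (criticalBeta 3) 0 BoundaryCondition.plus {0} with hM
  set G := criticalTwoPoint 3 ((n : ℤ) • (Pi.single 0 1 : Site 3)) with hG
  have hM0 : 0 ≤ M := SubPtolemyFloorPlusWall.boxMag_nonneg n
  have hG0 : 0 ≤ G := criticalTwoPoint_nonneg' _
  have hsub := approxSubmult_of_axisFloor hc h n hn
  -- `M² ≤ K g(2n+2) ≤ K c⁻¹ n^a G²`
  have hsq : M ^ 2 ≤ K * (c⁻¹ * (n : ℝ) ^ a * G ^ 2) :=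
    (hMB n hn).trans (mul_le_mul_of_nonneg_left hsub hK.le)
  have hhalf : ((n : ℝ) ^ (a / 2)) ^ 2 = (n : ℝ) ^ a := by
    rw [← Real.rpow_natCast, ← Real.rpow_mul hn0.le]; norm_num
  have htarget : (Real.sqrt (K / c) * (n : ℝ) ^ (a / 2) * G) ^ 2 = K * (c⁻¹ * (n : ℝ) ^ a * G ^ 2) := by
    rw [mul_pow, mul_pow, Real.sq_sqrt (by positivity), hhalf]; ring
  have h0 : 0 ≤ Real.sqrt (K / c) * (n : ℝ) ^ (a / 2) * G := by positivity
  exact (pow_le_pow_iff_left₀ hM0 h0 two_ne_zero).1 (htarget ▸ hsq)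

/-- **COSTUME + HARDER (box-hyperscaling-isotherm).** `MirrorBox(K)` together with the crux implies the
DEAD engine stub `stub_wallCost` of the line `Sketch-plus-wall-quotient-ladder` (`WallCost(q)` with `2q < L`),
hence (by `wallCost_consequences`) the crux AND a one-arm upper bound with exponent `< -1/4`. The card's
conjunction `MirrorBox ∧ IsothermFloor(δ₀ > 1+4/L)` implies the crux (its own glue), hence `stub_wallCost`. [folklore] -/
theorem stubWallCost_of_mirrorBox_of_crux {K : ℝ} (hK : 0 < K)
    (hMB : ∀ n : ℕ, 1 ≤ n →
      isingCorr (zdGraph 3) (box 3 n) (criticalBeta 3) 0 BoundaryCondition.plus {0} ^ 2 ≤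
        K * criticalTwoPoint 3 (((2 * n + 2 : ℕ) : ℤ) • (Pi.single 0 1 : Site 3)))
    (hF : SubPtolemyFloor) :
    ∃ q C : ℝ, 2 * q < Real.logb 2 (1 + Real.sqrt 2) ∧ 0 < C ∧ ∀ n : ℕ, 1 ≤ n →
      isingCorr (zdGraph 3) (box 3 n) (criticalBeta 3) 0 BoundaryCondition.plus {0} ≤
        C * (n : ℝ) ^ q * criticalTwoPoint 3 ((n : ℤ) • (Pi.single 0 1 : Site 3)) := by
  obtain ⟨a, c, ha, hc, h⟩ := hF
  refine ⟨a / 2, Real.sqrt (K / c), by linarith, by positivity, ?_⟩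
  exact wallCost_of_mirrorBox_of_axisFloor hK hc hMB h

/-- **Axial floor `(a, c)` ⇒ one-arm floor `M_n ≥ √(c·4^{-a})·n^{-a/2}`** (landed decoupling
`g(2n+2) ≤ M_n²`, p130950, and `(2n+2)^{-a} ≥ (4n)^{-a}` for `a ≥ 0`). [cite: FriedliVelenik2017, Exercise 3.15 (GKS decoupling ⟨σ_Aσ_B⟩_Λ⁺ ≤ ⟨σ_A⟩⁺_{Λ₁}⟨σ_B⟩⁺_{Λ₂})] -/
theorem oneArmFloor_of_axisFloor {a c : ℝ} (ha : 0 ≤ a) (hc : 0 < c)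
    (h : ∀ n : ℕ, 1 ≤ n →
      c * (n : ℝ) ^ (-a) ≤ criticalTwoPoint 3 ((n : ℤ) • (Pi.single 0 1 : Site 3))) :
    ∀ n : ℕ, 1 ≤ n →
      Real.sqrt (c * (4 : ℝ) ^ (-a)) * (n : ℝ) ^ (-(a / 2)) ≤
        isingCorr (zdGraph 3) (box 3 n) (criticalBeta 3) 0 BoundaryCondition.plus {0} := by
  intro n hn
  have hn0 : (0 : ℝ) < n := by exact_mod_cast hn
  set M := isingCorr (zdGraph 3) (box 3 n) (criticalBeta 3) 0 BoundaryCondition.plus {0} with hM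
  have hM0 : 0 ≤ M := SubPtolemyFloorPlusWall.boxMag_nonneg n
  have hD := SubPtolemyFloorPlusWall.stub_plusWallDecoupling n hn
  have hfl := h (2 * n + 2) (by omega)
  -- `(2n+2)^{-a} ≥ (4n)^{-a} = 4^{-a} n^{-a}`
  have hn1 : (1 : ℝ) ≤ n := by exact_mod_cast hn
  have hcmp : (4 : ℝ) ^ (-a) * (n : ℝ) ^ (-a) ≤ (((2 * n + 2 : ℕ) : ℝ)) ^ (-a) := by
    rw [← Real.mul_rpow (by norm_num) hn0.le]
    apply Real.rpow_le_rpow_of_nonpos (by positivity) _ (by linarith)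
    push_cast; linarith
  have hsq : (Real.sqrt (c * (4 : ℝ) ^ (-a)) * (n : ℝ) ^ (-(a / 2))) ^ 2 ≤ M ^ 2 := by
    have hhalf : ((n : ℝ) ^ (-(a / 2))) ^ 2 = (n : ℝ) ^ (-a) := by
      rw [← Real.rpow_natCast, ← Real.rpow_mul hn0.le]; norm_num
    calc (Real.sqrt (c * (4 : ℝ) ^ (-a)) * (n : ℝ) ^ (-(a / 2))) ^ 2
        = c * ((4 : ℝ) ^ (-a) * (n : ℝ) ^ (-a)) := by
          rw [mul_pow, Real.sq_sqrt (by positivity), hhalf]; ring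
      _ ≤ c * (((2 * n + 2 : ℕ) : ℝ)) ^ (-a) := mul_le_mul_of_nonneg_left hcmp hc.le
      _ ≤ criticalTwoPoint 3 ((((2 * n + 2 : ℕ) : ℤ)) • (Pi.single 0 1 : Site 3)) := by
          exact_mod_cast hfl
      _ ≤ M ^ 2 := hD
  have h0 : 0 ≤ Real.sqrt (c * (4 : ℝ) ^ (-a)) * (n : ℝ) ^ (-(a / 2)) := by positivity
  exact (pow_le_pow_iff_left₀ h0 hM0 two_ne_zero).1 hsq

/-- **The crux implies the one-arm floor with `2s < L`** (`s = a/2`, `1/2 ≤ s`): the intermediate currency of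
`box-hyperscaling-isotherm` (reached there via the isotherm and Tasaki's bound at `s = 2/(δ₀-1)`) is NECESSARY
for the crux. Rigorous frontier: `s = 1` (`boxMag_ge_inv`); `3/4+o(1)` conditionally (vEGPS 2025 Thm 1.12). [folklore] -/
theorem oneArmFloor_of_crux (hF : SubPtolemyFloor) :
    ∃ s c : ℝ, 1 / 2 ≤ s ∧ 2 * s < Real.logb 2 (1 + Real.sqrt 2) ∧ 0 < c ∧ ∀ n : ℕ, 1 ≤ n →
      c * (n : ℝ) ^ (-s) ≤ isingCorr (zdGraph 3) (box 3 n) (criticalBeta 3) 0 BoundaryCondition.plus {0} := by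
  obtain ⟨a, c, ha, hc, h⟩ := hF
  have h1 := SubPtolemyFloorNegative.exponent_ge_one hc h
  refine ⟨a / 2, Real.sqrt (c * (4 : ℝ) ^ (-a)), by linarith, by linarith, by positivity, fun n hn => ?_⟩
  simpa using oneArmFloor_of_axisFloor (by linarith) hc h n hn

/-- **`MirrorBox(K)` ∧ one-arm floor `(s, c)` ⇒ axial floor with exponent `2s`**:
`g(m) ≥ g(2m+2) ≥ M_m²/K ≥ (c²/K) m^{-2s}`. This is the card's glue with the isotherm step removed. [folklore] -/
theorem axisFloor_of_mirrorBox_of_oneArmFloor {K s c : ℝ} (hK : 0 < K) (hc : 0 < c)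
    (hMB : ∀ n : ℕ, 1 ≤ n →
      isingCorr (zdGraph 3) (box 3 n) (criticalBeta 3) 0 BoundaryCondition.plus {0} ^ 2 ≤
        K * criticalTwoPoint 3 (((2 * n + 2 : ℕ) : ℤ) • (Pi.single 0 1 : Site 3)))
    (h : ∀ n : ℕ, 1 ≤ n →
      c * (n : ℝ) ^ (-s) ≤ isingCorr (zdGraph 3) (box 3 n) (criticalBeta 3) 0 BoundaryCondition.plus {0}) :
    ∀ n : ℕ, 1 ≤ n →
      c ^ 2 / K * (n : ℝ) ^ (-(2 * s)) ≤ criticalTwoPoint 3 ((n : ℤ) • (Pi.single 0 1 : Site 3)) := by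
  intro n hn
  have hn0 : (0 : ℝ) < n := by exact_mod_cast hn
  set M := isingCorr (zdGraph 3) (box 3 n) (criticalBeta 3) 0 BoundaryCondition.plus {0} with hM
  have hcn : 0 ≤ c * (n : ℝ) ^ (-s) := by positivity
  have hsq : (c * (n : ℝ) ^ (-s)) ^ 2 ≤ M ^ 2 := pow_le_pow_left₀ hcn (h n hn) 2
  have htwo : ((n : ℝ) ^ (-s)) ^ 2 = (n : ℝ) ^ (-(2 * s)) := by
    rw [← Real.rpow_natCast, ← Real.rpow_mul hn0.le]; ring_nf
  have hchain : c ^ 2 * (n : ℝ) ^ (-(2 * s)) ≤ K * criticalTwoPoint 3 ((n : ℤ) • (Pi.single 0 1 : Site 3)) := by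
    calc c ^ 2 * (n : ℝ) ^ (-(2 * s)) = (c * (n : ℝ) ^ (-s)) ^ 2 := by rw [mul_pow, htwo]
      _ ≤ M ^ 2 := hsq
      _ ≤ K * criticalTwoPoint 3 (((2 * n + 2 : ℕ) : ℤ) • (Pi.single 0 1 : Site 3)) := hMB n hn
      _ ≤ K * criticalTwoPoint 3 ((n : ℤ) • (Pi.single 0 1 : Site 3)) :=
          mul_le_mul_of_nonneg_left (axis_double_succ_le n) hK.le
  rw [div_mul_eq_mul_div, div_le_iff₀ hK]
  linarith [hchain]

/-- **`MirrorBox(K)` ∧ one-arm floor with `2s < L` ⇒ the crux.** [folklore] -/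
theorem crux_of_mirrorBox_of_oneArmFloor {K : ℝ} (hK : 0 < K)
    (hMB : ∀ n : ℕ, 1 ≤ n →
      isingCorr (zdGraph 3) (box 3 n) (criticalBeta 3) 0 BoundaryCondition.plus {0} ^ 2 ≤
        K * criticalTwoPoint 3 (((2 * n + 2 : ℕ) : ℤ) • (Pi.single 0 1 : Site 3)))
    (hA : ∃ s c : ℝ, 2 * s < Real.logb 2 (1 + Real.sqrt 2) ∧ 0 < c ∧ ∀ n : ℕ, 1 ≤ n →
      c * (n : ℝ) ^ (-s) ≤ isingCorr (zdGraph 3) (box 3 n) (criticalBeta 3) 0 BoundaryCondition.plus {0}) :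
    SubPtolemyFloor := by
  obtain ⟨s, c, hs, hc, h⟩ := hA
  exact ⟨2 * s, c ^ 2 / K, hs, by positivity, axisFloor_of_mirrorBox_of_oneArmFloor hK hc hMB h⟩

/-- **COSTUME (box-hyperscaling-isotherm).** GIVEN the card's exponent-free factor `MirrorBox(K)`, the crux is
EQUIVALENT to a one-arm floor `M_n ≥ c n^{-s}` with `2s < L` — the crux's own exponent content in one-arm
currency (`→` needs no `MirrorBox`: `oneArmFloor_of_crux`). The card's thermodynamic factor must therefore deliver
exactly this (via Tasaki, `s = 2/(δ₀-1) < L/2 ⇔ δ₀ > 1 + 4/L`), against the rigorous `s = 1` / `δ = 3`. [folklore] -/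
theorem crux_iff_oneArmFloor_of_mirrorBox {K : ℝ} (hK : 0 < K)
    (hMB : ∀ n : ℕ, 1 ≤ n →
      isingCorr (zdGraph 3) (box 3 n) (criticalBeta 3) 0 BoundaryCondition.plus {0} ^ 2 ≤
        K * criticalTwoPoint 3 (((2 * n + 2 : ℕ) : ℤ) • (Pi.single 0 1 : Site 3))) :
    SubPtolemyFloor ↔
      ∃ s c : ℝ, 2 * s < Real.logb 2 (1 + Real.sqrt 2) ∧ 0 < c ∧ ∀ n : ℕ, 1 ≤ n →
        c * (n : ℝ) ^ (-s) ≤ isingCorr (zdGraph 3) (box 3 n) (criticalBeta 3) 0 BoundaryCondition.plus {0} := by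
  constructor
  · intro hF
    obtain ⟨s, c, -, hs, hc, h⟩ := oneArmFloor_of_crux hF
    exact ⟨s, c, hs, hc, h⟩
  · exact crux_of_mirrorBox_of_oneArmFloor hK hMB

/-- **`MirrorBox` consequences in one line**: with the crux it yields the dead `WallCost` stub, and by itself
a one-arm upper bound with exponent `-1/2 < -1/4` (same shape as `wallCost_consequences`). [cite: VanEngelenburgGarbanPanisSevero2025, remark after Thm. 1.12 (polynomial upper bound on the one-arm probability in d = 3 open)] -/
theorem mirrorBox_consequences {K : ℝ} (hK : 0 < K)
    (hMB : ∀ n : ℕ, 1 ≤ n →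
      isingCorr (zdGraph 3) (box 3 n) (criticalBeta 3) 0 BoundaryCondition.plus {0} ^ 2 ≤
        K * criticalTwoPoint 3 (((2 * n + 2 : ℕ) : ℤ) • (Pi.single 0 1 : Site 3))) :
    ∃ C s : ℝ, 0 < C ∧ s < -(1 / 4) ∧ ∀ n : ℕ, 1 ≤ n →
      isingCorr (zdGraph 3) (box 3 n) (criticalBeta 3) 0 BoundaryCondition.plus {0} ≤ C * (n : ℝ) ^ s := by
  obtain ⟨C, hC, h⟩ := boxMag_le_rpow_of_mirrorBox hK hMB
  exact ⟨C, -(1 / 2), hC, by norm_num, h⟩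

end Summit.CriticalPhenomena.Ising3DConformalLimit.SubPtolemyFloorNegative

end
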